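import Summits.HodgeConjecture.HodgeConjecture.Theorems.AnchorTransportVariationalHodgeCorrespondenceTransport
import Literature.AlgebraicGeometry.Motives.SubschemeCycles
import Literature.AlgebraicGeometry.HodgeTheory.FermatHypersurfaceReduction
import Literature.AlgebraicGeometry.Motives.VarietiesProperProofs

/-!
# Route AnchorTransport — `VariationalHodge` (stmt-HodgeConjecture-1076): the crux holds for TRIVIAL families

The first instance of the crux `AnchorTransport.VariationalHodge` proved on the tree's carriers through
its VARIATIONAL hypotheses (irreducibility and smoothness of the base, the anchor) rather than through
the Hodge conjecture on the target fibre: for the trivial family `X × S ⟶ S` of a smooth projective `X`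
over a smooth irreducible separated quasi-compact (e.g. affine) base `S` and ANY class
`A ∈ H²ᵖ((X × S)(ℂ); ℂ)` — not necessarily pulled back from `X` — algebraicity of `A|_{X × {s₀}}` at
one complex point forces algebraicity of `A|_{X × {s}}` at every complex point. Proof: transport the
anchor class through the canonical isomorphisms `(X × S)_s ≅ X` (`mem_algebraicClasses_of_transportedAnchor`
of `AnchorTransportVariationalHodgeCorrespondenceTransport`): the transported classes glue to the
pull-back to `X × S` of the anchor class read in `H²ᵖ(X(ℂ))`, so `A` and that pull-back agree on the
fibre at `s₀`, hence — restrictions of global classes being flat sections over the connected `S(ℂ)`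
(Ehresmann) — on every fibre, where the pull-back is algebraic by transport of algebraicity along
isomorphisms. (Primed names avoid the homonymous lemmas of `AnchorTransportTargetIffHodgeConjecture`,
which cannot be imported here without the route file's import cone.) Irreducibility of `S` is genuinely used (over `S = {s₀} ⊔ {s}` the statement fails for
`A = (algebraic, anything)`), no rationality or Hodge-type hypothesis is.

* the trivial family is `Motives.familyPullback (toSpecOver X) (toSpecOver S)` — `X × S ⟶ S` as the
  base change of the constant family `X ⟶ Spec ℂ` (`isSmoothProjectiveFamily_familyPullback_toSpecOver`;
  its fibres are `X`: `fiberOverFamilyPullbackIso` followed by the iso fibre inclusion of the constant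
  family, `isIso_fiberι_toSpecOver'`);
* `variationalHodge_conclusion_trivialFamily` — the theorem (base separated and quasi-compact);
  `variationalHodge_conclusion_trivialFamily_affine` — affine base.
-/

noncomputable section

-- every declaration of this problem lives in `Summit.HodgeConjecture.HodgeConjecture.…` (summit = sub-problem)
set_option linter.dupNamespace false

open CategoryTheory CategoryTheory.Limits AlgebraicGeometry TopologicalSpace
open Literature.AlgebraicGeometry.Motives Literature.AlgebraicGeometry.HodgeTheory

namespace Summit.HodgeConjecture.HodgeConjecture.Theorems

variable {n : ℕ} (X S : SchemeOver ℂ)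

/-! ### The constant family `X ⟶ Spec ℂ` and the trivial family `X × S ⟶ S` -/

/-- The structure map of `specOver ℂ ℂ` is an isomorphism (it is `Spec` of the identity). [folklore] -/
theorem isIso_specOver_hom : IsIso (specOver ℂ ℂ).hom := by
  have h : (specOver ℂ ℂ).hom = 𝟙 _ := by
    change Spec.map (CommRingCat.ofHom (algebraMap ℂ ℂ)) = 𝟙 _
    rw [show CommRingCat.ofHom (algebraMap ℂ ℂ) = 𝟙 _ from rfl, Spec.map_id]
  rw [h]
  exact IsIso.id _

variable {X S} in
/-- A complex point of `Spec ℂ` has an isomorphism as underlying morphism. [folklore] -/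
theorem isIso_left_complexPoints_specOver (s : ComplexPoints (specOver ℂ ℂ)) : IsIso s.left := by
  haveI := isIso_specOver_hom
  haveI : IsIso (s.left ≫ (specOver ℂ ℂ).hom) := by
    rw [Over.w s]
    exact isIso_specOver_hom
  exact IsIso.of_isIso_comp_right s.left (specOver ℂ ℂ).hom

variable {X} in
/-- Every fibre inclusion of the constant family `X ⟶ Spec ℂ` is an isomorphism. [folklore] -/
theorem isIso_fiberι_toSpecOver' (s : ComplexPoints (specOver ℂ ℂ)) :
    IsIso (fiberι (toSpecOver X) s) := by
  haveI := isIso_left_complexPoints_specOver s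
  haveI : IsIso ((Over.forget _).map (fiberι (toSpecOver X) s)) := by
    change IsIso (pullback.fst (toSpecOver X).left s.left)
    infer_instance
  exact isIso_of_reflects_iso _ (Over.forget _)

variable {X} in
/-- The constant family `X ⟶ Spec ℂ` of a smooth projective `X` is a smooth projective family.
[folklore] -/
theorem isSmoothProjectiveFamily_toSpecOver' (hX : IsSmoothProjective n X) :
    IsSmoothProjectiveFamily (toSpecOver X) n where
  smoothOfRelativeDimension := hX.smoothOfRelativeDimension
  isProper := IsSmoothProjective.isProper_holds hX
  isSmoothProjective s :=
    haveI := isIso_fiberι_toSpecOver' (X := X) s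
    hX.of_iso (asIso (fiberι (toSpecOver X) s)).symm

variable {X} in
/-- The trivial family `X × S ⟶ S` of a smooth projective `X` — the base change
`Motives.familyPullback (toSpecOver X) (toSpecOver S)` of the constant family `X ⟶ Spec ℂ` along
`S ⟶ Spec ℂ` — is a smooth projective family. [folklore] -/
theorem isSmoothProjectiveFamily_familyPullback_toSpecOver (hX : IsSmoothProjective n X) :
    IsSmoothProjectiveFamily (familyPullback.snd (toSpecOver X) (toSpecOver S)) n :=
  (isSmoothProjectiveFamily_toSpecOver' hX).familyPullback_snd _

/-! ### The crux for trivial families -/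

variable {X S} in
/-- **Grothendieck's variational Hodge statement holds for trivial families.** Let `X` be smooth
projective of dimension `n`, `S` a smooth irreducible separated quasi-compact `ℂ`-scheme,
`A ∈ H²ᵖ((X × S)(ℂ); ℂ)` any class on the trivial family and `s₀, s ∈ S(ℂ)`. If `A|_{(X × S)_{s₀}}` is
algebraic then `A|_{(X × S)_s}` is algebraic. Apply `mem_algebraicClasses_of_transportedAnchor` to the
operators `T_t = (e_t)^* ∘ (e_{s₀}^{-1})^*`, `e_t : (X × S)_t ≅ X`: they preserve algebraic classes
(`mem_algebraicClasses_map_of_iso`), fix the anchor (`map_hom_map_inv_apply`), and glue on the anchor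
class to the global class `pr_X^* (e_{s₀}^{-1})^* (A|_{s₀})` because `e_t = X_t ⟶ X × S ⟶ X`
(`fiberOverFamilyPullbackIso_hom_fiberι`). Irreducibility of `S` (connectedness of `S(ℂ)`) is essential.
[folklore] -/
theorem variationalHodge_conclusion_trivialFamily (hX : IsSmoothProjective n X)
    [IrreducibleSpace S.left] [AlgebraicGeometry.Smooth S.hom] [IsSeparated S.hom] [CompactSpace S.left]
    (p : ℕ) (A : complexBetti (familyPullback (toSpecOver X) (toSpecOver S)) (2 * p)) (s₀ : ComplexPoints S)
    (h₀ : complexBetti.map (fiberι (familyPullback.snd (toSpecOver X) (toSpecOver S)) s₀) (2 * p) A ∈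
      algebraicClasses (fiberOver (familyPullback.snd (toSpecOver X) (toSpecOver S)) s₀) p)
    (s : ComplexPoints S) :
    complexBetti.map (fiberι (familyPullback.snd (toSpecOver X) (toSpecOver S)) s) (2 * p) A ∈
      algebraicClasses (fiberOver (familyPullback.snd (toSpecOver X) (toSpecOver S)) s) p := by
  set f := familyPullback.snd (toSpecOver X) (toSpecOver S) with hfdef
  have hf : IsSmoothProjectiveFamily f n := isSmoothProjectiveFamily_familyPullback_toSpecOver S hX
  -- the fibre isomorphisms `e t : (X × S)_t ≅ X`, equal to `X_t ⟶ X × S ⟶ X`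
  haveI := fun t : ComplexPoints S => isIso_fiberι_toSpecOver' (X := X) (AlgPoints.map (toSpecOver S) t)
  let e : ∀ t : ComplexPoints S, fiberOver f t ≅ X := fun t =>
    fiberOverFamilyPullbackIso (toSpecOver X) (toSpecOver S) t ≪≫
      asIso (fiberι (toSpecOver X) (AlgPoints.map (toSpecOver S) t))
  have he : ∀ t, (e t).hom = fiberι f t ≫ familyPullback.fst (toSpecOver X) (toSpecOver S) := fun t =>
    fiberOverFamilyPullbackIso_hom_fiberι (toSpecOver X) (toSpecOver S) t
  -- the anchor class read on `X`
  set c : complexBetti X (2 * p) := complexBetti.map (e s₀).inv (2 * p)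
    (complexBetti.map (fiberι f s₀) (2 * p) A) with hc
  refine mem_algebraicClasses_of_transportedAnchor f hf p A s₀
    (fun t d => complexBetti.map (e t).hom (2 * p) (complexBetti.map (e s₀).inv (2 * p) d))
    (fun t d hd => ?_) ⟨complexBetti.map (familyPullback.fst (toSpecOver X) (toSpecOver S)) (2 * p) c,
      fun t => ?_⟩ ?_ h₀ s
  · -- (i) transport of algebraicity along the two isomorphisms
    exact mem_algebraicClasses_map_of_iso hX (hf.isSmoothProjective t) (e t)
      (mem_algebraicClasses_map_of_iso (hf.isSmoothProjective s₀) hX (e s₀).symm hd)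
  · -- (ii) gluing: `e_t^* c = (X_t ⟶ X × S ⟶ X)^* c`
    change complexBetti.map (e t).hom (2 * p) c = _
    rw [he t, complexBetti.map_comp, ModuleCat.comp_apply]
  · -- (iii) the anchor is fixed
    exact map_hom_map_inv_apply (e s₀) (2 * p) _

variable {X S} in
/-- **The same over an affine base** (affine schemes are separated and quasi-compact). [folklore] -/
theorem variationalHodge_conclusion_trivialFamily_affine (hX : IsSmoothProjective n X)
    [IrreducibleSpace S.left] [AlgebraicGeometry.Smooth S.hom] [IsAffine S.left]
    (p : ℕ) (A : complexBetti (familyPullback (toSpecOver X) (toSpecOver S)) (2 * p)) (s₀ : ComplexPoints S)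
    (h₀ : complexBetti.map (fiberι (familyPullback.snd (toSpecOver X) (toSpecOver S)) s₀) (2 * p) A ∈
      algebraicClasses (fiberOver (familyPullback.snd (toSpecOver X) (toSpecOver S)) s₀) p)
    (s : ComplexPoints S) :
    complexBetti.map (fiberι (familyPullback.snd (toSpecOver X) (toSpecOver S)) s) (2 * p) A ∈
      algebraicClasses (fiberOver (familyPullback.snd (toSpecOver X) (toSpecOver S)) s) p := by
  haveI : IsAffineHom S.hom := inferInstance
  haveI : IsSeparated S.hom := inferInstance
  haveI : CompactSpace S.left := isCompact_univ_iff.mp (isAffineOpen_top S.left).isCompact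
  exact variationalHodge_conclusion_trivialFamily hX p A s₀ h₀ s

end Summit.HodgeConjecture.HodgeConjecture.Theorems

end
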